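/-
Copyright: rh-split cell, seat prover-l1 (L1/L19 «DUST WALL»), 2026-08-27.  Plane topology.
Nothing here bears on the truth of RH.
-/
import Mathlib.Analysis.Complex.Convex
import Mathlib.Analysis.Complex.ReImTopology
import Mathlib.Analysis.Real.Cardinality
import HarnessLib

/-!
# Uniform grids in the plane: cells, centres, indices, and grids avoiding a countable set

Elementary bookkeeping for the grid-cycle construction of the crux `PointComponentInvisible` (route
`ScrewDustWall`, X-11 «DUST WALL», stmt-RiemannHypothesis-21690).  A UNIFORM GRID has vertical lines at
`x m = a₁ + δ m` and horizontal lines at `y n = a₂ + δ n` (`δ > 0`); its closed cell `(m, n)` is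
`[x m, x (m+1)] × [y n, y (n+1)]`, its open cell the interior.  We record: every point lies in the
closed cell of its INDEX (floor); two points of a cell are `2δ`-close; the CENTRE of a cell lies in the
open cell; an open cell meets no other closed cell; closed cells lie in the closure of their open cells;
and a grid can be translated so that a given countable set avoids all grid lines
(`exists_grid_avoiding`, since `ℝ` is uncountable).

No `sorry`, no new axioms, no definitions, no instances, no notation.
-/

set_option linter.dupNamespace false

namespace Summit.RiemannHypothesis.RiemannHypothesis.Theorems.Splittings.ScrewDust

open Complex Filter Topology Set Metric

/-- On a uniform grid `x m = a₁ + δ m`, consecutive lines are `δ` apart. -/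
theorem grid_succ {x : ℤ → ℝ} {a₁ δ : ℝ} (hx : ∀ m, x m = a₁ + δ * m) (m : ℤ) :
    x (m + 1) = x m + δ := by
  rw [hx, hx]; push_cast; ring

/-- On a uniform grid, `x` is monotone in steps: `x m ≤ x (m + 1)` (`0 ≤ δ`). -/
theorem grid_le_succ {x : ℤ → ℝ} {a₁ δ : ℝ} (hx : ∀ m, x m = a₁ + δ * m) (hδ : 0 ≤ δ) (m : ℤ) :
    x m ≤ x (m + 1) := by
  rw [grid_succ hx]; linarith

/-- On a uniform grid, `x` is monotone. -/
theorem grid_mono {x : ℤ → ℝ} {a₁ δ : ℝ} (hx : ∀ m, x m = a₁ + δ * m) (hδ : 0 ≤ δ) : Monotone x :=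
  fun m m' h ↦ by rw [hx, hx]; gcongr

/-- Every real lies in the grid interval of its floor index. -/
theorem mem_Icc_floor {x : ℤ → ℝ} {a₁ δ : ℝ} (hx : ∀ m, x m = a₁ + δ * m) (hδ : 0 < δ) (t : ℝ) :
    t ∈ Icc (x ⌊(t - a₁) / δ⌋) (x (⌊(t - a₁) / δ⌋ + 1)) := by
  rw [hx, hx]
  have h1 := Int.floor_le ((t - a₁) / δ)
  have h2 := Int.lt_floor_add_one ((t - a₁) / δ)
  constructor
  · have : δ * (⌊(t - a₁) / δ⌋ : ℝ) ≤ δ * ((t - a₁) / δ) := mul_le_mul_of_nonneg_left h1 hδ.le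
    rw [mul_div_cancel₀ _ hδ.ne'] at this
    linarith
  · have : δ * ((t - a₁) / δ) ≤ δ * ((⌊(t - a₁) / δ⌋ : ℝ) + 1) :=
      mul_le_mul_of_nonneg_left h2.le hδ.le
    rw [mul_div_cancel₀ _ hδ.ne'] at this
    push_cast
    linarith

/-- Every point lies in the closed cell of its index. -/
theorem mem_cell_floor {x y : ℤ → ℝ} {a₁ a₂ δ : ℝ} (hx : ∀ m, x m = a₁ + δ * m)
    (hy : ∀ n, y n = a₂ + δ * n) (hδ : 0 < δ) (z : ℂ) :
    z ∈ Icc (x ⌊(z.re - a₁) / δ⌋) (x (⌊(z.re - a₁) / δ⌋ + 1)) ×ℂ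
      Icc (y ⌊(z.im - a₂) / δ⌋) (y (⌊(z.im - a₂) / δ⌋ + 1)) :=
  ⟨mem_Icc_floor hx hδ z.re, mem_Icc_floor hy hδ z.im⟩

/-- Two points of a closed cell are `2δ`-close. -/
theorem dist_le_of_mem_cell {x y : ℤ → ℝ} {a₁ a₂ δ : ℝ} (hx : ∀ m, x m = a₁ + δ * m)
    (hy : ∀ n, y n = a₂ + δ * n) {k : ℤ × ℤ} {v w : ℂ}
    (hv : v ∈ Icc (x k.1) (x (k.1 + 1)) ×ℂ Icc (y k.2) (y (k.2 + 1)))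
    (hw : w ∈ Icc (x k.1) (x (k.1 + 1)) ×ℂ Icc (y k.2) (y (k.2 + 1))) : dist v w ≤ 2 * δ := by
  rw [mem_reProdIm, mem_Icc, mem_Icc, grid_succ hx, grid_succ hy] at hv hw
  rw [dist_eq_norm]
  refine (norm_le_abs_re_add_abs_im _).trans ?_
  rw [sub_re, sub_im]
  have h1 : |v.re - w.re| ≤ δ := abs_sub_le_iff.2 ⟨by linarith [hv.1.2, hw.1.1], by linarith [hv.1.1, hw.1.2]⟩
  have h2 : |v.im - w.im| ≤ δ := abs_sub_le_iff.2 ⟨by linarith [hv.2.2, hw.2.1], by linarith [hv.2.1, hw.2.2]⟩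
  linarith

/-- The centre of a cell lies in the open cell. -/
theorem center_mem_cello {x y : ℤ → ℝ} {a₁ a₂ δ : ℝ} (hx : ∀ m, x m = a₁ + δ * m)
    (hy : ∀ n, y n = a₂ + δ * n) (hδ : 0 < δ) (k : ℤ × ℤ) :
    ((x k.1 + δ / 2 : ℝ) : ℂ) + (y k.2 + δ / 2 : ℝ) * I ∈
      Ioo (x k.1) (x (k.1 + 1)) ×ℂ Ioo (y k.2) (y (k.2 + 1)) := by
  rw [mem_reProdIm, grid_succ hx, grid_succ hy]
  refine ⟨⟨?_, ?_⟩, ?_, ?_⟩ <;> simp <;> linarith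

/-- The open cell lies in the closed cell. -/
theorem cello_subset_cell (x y : ℤ → ℝ) (k : ℤ × ℤ) :
    Ioo (x k.1) (x (k.1 + 1)) ×ℂ Ioo (y k.2) (y (k.2 + 1)) ⊆
      Icc (x k.1) (x (k.1 + 1)) ×ℂ Icc (y k.2) (y (k.2 + 1)) :=
  fun _ hz ↦ ⟨Ioo_subset_Icc_self hz.1, Ioo_subset_Icc_self hz.2⟩

/-- An open cell of a uniform grid meets no OTHER closed cell. -/
theorem eq_of_mem_cello_of_mem_cell {x y : ℤ → ℝ} {a₁ a₂ δ : ℝ} (hx : ∀ m, x m = a₁ + δ * m)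
    (hy : ∀ n, y n = a₂ + δ * n) (hδ : 0 < δ) {v : ℂ} {k j : ℤ × ℤ}
    (hk : v ∈ Ioo (x k.1) (x (k.1 + 1)) ×ℂ Ioo (y k.2) (y (k.2 + 1)))
    (hj : v ∈ Icc (x j.1) (x (j.1 + 1)) ×ℂ Icc (y j.2) (y (j.2 + 1))) : j = k := by
  rw [mem_reProdIm, mem_Ioo, mem_Ioo] at hk
  rw [mem_reProdIm, mem_Icc, mem_Icc] at hj
  have h1 : ∀ {f : ℤ → ℝ} {a : ℝ}, (∀ m, f m = a + δ * m) → ∀ {m m' : ℤ} {t : ℝ},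
      f m < t → t < f (m + 1) → f m' ≤ t → t ≤ f (m' + 1) → m' = m := by
    intro f a hf m m' t h1 h2 h3 h4
    rw [hf] at h1 h2 h3 h4
    push_cast at h2 h4
    by_contra hne
    rcases lt_or_gt_of_ne hne with h | h
    · have : (m' : ℝ) + 1 ≤ m := by exact_mod_cast h
      nlinarith
    · have : (m : ℝ) + 1 ≤ m' := by exact_mod_cast h
      nlinarith
  exact Prod.ext (h1 hx hk.1.1 hk.1.2 hj.1.1 hj.1.2) (h1 hy hk.2.1 hk.2.2 hj.2.1 hj.2.2)

/-- A closed cell lies in the closure of its open cell (`δ > 0`). -/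
theorem cell_subset_closure_cello {x y : ℤ → ℝ} {a₁ a₂ δ : ℝ} (hx : ∀ m, x m = a₁ + δ * m)
    (hy : ∀ n, y n = a₂ + δ * n) (hδ : 0 < δ) (k : ℤ × ℤ) :
    Icc (x k.1) (x (k.1 + 1)) ×ℂ Icc (y k.2) (y (k.2 + 1)) ⊆
      closure (Ioo (x k.1) (x (k.1 + 1)) ×ℂ Ioo (y k.2) (y (k.2 + 1))) := by
  have h1 : x k.1 ≠ x (k.1 + 1) := by rw [grid_succ hx]; linarith
  have h2 : y k.2 ≠ y (k.2 + 1) := by rw [grid_succ hy]; linarith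
  rw [closure_reProdIm, closure_Ioo h1, closure_Ioo h2]

/-- A point on no grid line that lies in a closed cell lies in the open cell. -/
theorem mem_cello_of_not_mem_lines {x y : ℤ → ℝ} {q : ℂ} (hq₁ : ∀ m, q.re ≠ x m)
    (hq₂ : ∀ n, q.im ≠ y n) (k : ℤ × ℤ) :
    q ∈ Ioo (x k.1) (x (k.1 + 1)) ×ℂ Ioo (y k.2) (y (k.2 + 1)) ∨
      q ∉ Icc (x k.1) (x (k.1 + 1)) ×ℂ Icc (y k.2) (y (k.2 + 1)) := by
  by_cases h : q ∈ Icc (x k.1) (x (k.1 + 1)) ×ℂ Icc (y k.2) (y (k.2 + 1))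
  · left
    rw [mem_reProdIm, mem_Icc, mem_Icc] at h
    exact ⟨⟨lt_of_le_of_ne h.1.1 (fun e ↦ hq₁ _ e.symm), lt_of_le_of_ne h.1.2 (fun e ↦ hq₁ _ e)⟩,
      ⟨lt_of_le_of_ne h.2.1 (fun e ↦ hq₂ _ e.symm), lt_of_le_of_ne h.2.2 (fun e ↦ hq₂ _ e)⟩⟩
  · exact Or.inr h

/-- **Grids avoiding a countable set.**  For a countable `T ⊆ ℂ` and `δ > 0` there is a uniform grid of
mesh `δ` none of whose lines passes through a point of `T` (`ℝ` is uncountable). -/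
theorem exists_grid_avoiding {T : Set ℂ} (hT : T.Countable) (δ : ℝ) :
    ∃ a₁ a₂ : ℝ, (∀ q ∈ T, ∀ m : ℤ, q.re ≠ a₁ + δ * m) ∧ (∀ q ∈ T, ∀ n : ℤ, q.im ≠ a₂ + δ * n) := by
  have key : ∀ f : ℂ → ℝ, ∃ a : ℝ, ∀ q ∈ T, ∀ m : ℤ, f q ≠ a + δ * m := by
    intro f
    set S : Set ℝ := ⋃ q ∈ T, ⋃ m : ℤ, {f q - δ * m} with hS
    have hSc : S.Countable := hT.biUnion fun q _ ↦ countable_iUnion fun m ↦ countable_singleton _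
    obtain ⟨a, ha⟩ : ∃ a : ℝ, a ∉ S := by
      by_contra h
      push Not at h
      exact Cardinal.not_countable_real (hSc.mono fun a _ ↦ h a)
    refine ⟨a, fun q hq m e ↦ ha ?_⟩
    rw [hS]
    exact mem_iUnion₂.2 ⟨q, hq, mem_iUnion.2 ⟨m, by rw [mem_singleton_iff, e]; ring⟩⟩
  obtain ⟨a₁, h₁⟩ := key Complex.re
  obtain ⟨a₂, h₂⟩ := key Complex.im
  exact ⟨a₁, a₂, h₁, h₂⟩

end Summit.RiemannHypothesis.RiemannHypothesis.Theorems.Splittings.ScrewDust
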